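import Summits.BirchSwinnertonDyer.BirchSwinnertonDyer.Theorems.QuadraticBranchSignedControlThm74OfColemanPoitouTateFact
import Literature.NumberTheory.EllipticCurves.GreenbergVatsal2000.CongruentCurves
import Literature.NumberTheory.EllipticCurves.IwasawaAlgebraMuVanishingProofs
import Literature.NumberTheory.EllipticCurves.IwasawaAlgebraMuAdditiveProofs
import Literature.NumberTheory.EllipticCurves.KatoFineSelmerFiniteProofs
import Summits.BirchSwinnertonDyer.Rank1Residual.X11a.MuLambdaSplit
import HarnessLib

/-!
# Route `QuadraticBranchSignedControl` (rung K8, cell `bsd-potss`), residual crux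
# `PlusEtaMainConjectureNonsurj` (stmt-BirchSwinnertonDyer-19606): the FINE ROAD, part 1 (algebra + the
# pinned `η`-frame) — `μ(X⁺(V/K_∞)^η) ≤ μ(L_p⁺(V,η,X)) + μ(X⁰(W/ℚ_∞))` and `μ(X⁰(W/ℚ_∞)) ≤ μ(X⁺(V/K_∞)^η)`
# along Kobayashi's (7.21) at `η` (seat `bsd-potss-k8eta-c2` g6)

WHAT. After seats g2–g5 the crux 19606 on every census row is the `μ`-statement `μ(X⁺(V/K_∞)^η) = 0`
(skeleton v4 stubs `stub_etaMC_r0_mu` / `stub_etaMC_r1_mu`; plus L₀ on the non-CM rank-`0` rows). The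
only roads to that `μ` in the tree were a CONGRUENT ANCHOR with `μ = 0` known (Hatley–Lei Thm. 4.6, g3/g5)
or a UNIT row (g2) — and no member of the mod-`p` congruence class of a 19606 row has an image containing
`SL₂(ℤ_p)` (all members are `X_ns⁺(p)` rows or CM), so Kato's integral bound is never importable (g5
FINDING §2: the «kernel» `σ = −1 ∧ K_V ≠ ℚ(√−3)` has no road). THIS FILE and its sequel
(`…PlusEtaNonsurjFineRoadConjA`) open a road with NO anchor and NO image hypothesis: the `μ`-projection
of the `η`-component of Kobayashi's four-term sequence (7.21) (proof of Thm. 7.4, p. 13),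
`0 → 𝐇¹(T)^η/Z(T)^η → Λ^η/(L_p⁺(V,η,X)) → X⁺(V/K_∞)^η → X⁰(V/K_∞)^η → 0`, read on seat k8q-c3 g6's
PINNED frame `Kobayashi2003.EtaColemanPoitouTateData` (named fact `thm62_63_73_etaColemanPoitouTate`),
whose right end `X⁰(V/K_∞)^η` IS the dual fine Selmer group `X⁰(W/ℚ_∞)` of the twist `W = V ⊗ η`
(`WeierstrassCurve.FineSelmerDualData W κ γ`, flag `Kob03-eta-twist-currency`). `μ` is additive along
exact sequences of finitely generated torsion `Λ`-modules, so
`μ(X⁺(V/K_∞)^η) = μ(L_p⁺(V,η,X)) − μ(𝐇¹^η/Z^η) + μ(X⁰(W/ℚ_∞))`: with the ANALYTIC `μ(L_p⁺(V,η,X)) = 0`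
(per-row computable; PARI `ellpadiclambdamu`: 537/537 non-onto rows below `5·10⁵`, g3 kit
j269184/j269393/j269813) the `μ`-stub of 19606 at a row is EQUIVALENT to «`X⁰(W/ℚ_∞)` finitely generated
over `ℤ_p`» — Coates–Sujatha's statement (A) for the ADDITIVE partner `W` at `p`, the SAME named open
problem the sister rungs carry (K9 item 19386 at `(E,3)`, KT's (t′) twin) in the SAME cell currency
(`DeoRaySujatha2023.thm39_…`, `LimSujatha2018.prop32_…` (PROVED: (A) is a mod-`p` congruence invariant),
`Kato2004.rankZero_…_of_additive_potGood_of_irreducible_of_fineSelmerDual_fg`). The `η`-signed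
supersingular twin of rung K6's `Kato2004.mu_eq_zero_of_fine_mu_eq_zero` (class X9, ordinary).

* §1 (pure `Λ`-algebra) along `0 → A → Λ/(L) → X → B → 0` (`L ≠ 0`, `B` f.g. torsion):
  `char(X)·char(A) = (L)·char(B)`; generators `x ∣ b·L`, `a ∣ L`; `p ∤ L ∧ p ∤ b ⟹ p ∤ x` (`p` prime
  in `Λ`); the same with `B` finitely generated over `ℤ_p` (Washington §13.2); conversely
  `μ(X) = 0 ⟹ B` finitely generated over `ℤ_p` along `X ↠ B`.
* §2 on the PINNED frame `E : EtaColemanPoitouTateData p K₀ η V f ϖ κ γ W I FB`: the plus four-term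
  sequence; `p ∤ Col⁺(z) ∧ X⁰(W/ℚ_∞)` f.g./`ℤ_p` `⟹` every characteristic generator of every datum of
  `Sel⁺(V/K_∞)^η` has unit content (`eta_hasUnitContent_of_fine`); conversely
  (`fine_moduleFinite_of_eta_hasUnitContent`); the left end for free (`left_hasUnitContent_of_analyticMu`).
The class-level statements (named facts in hypothesis position, (A) in the cell's `∃ γ D` currency) and
the compositions with the landed rank-`0` / CM / prime-`L` roads are the sequel file.

HONEST FRAMING (cell `bsd-potss`, run/shared/lean/pub/bsd-potss/; FULL-BSD rank ≤ 1 programme, HUMAN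
RULING D-0036/D-0074): TOOL THEOREMS ONLY — no definition, no named Literature fact minted, no
Summits-side `def … : Prop`, no `sorry`, axioms standard. §1 is unconditional algebra; §2 is relative to
a frame datum (an inhabitant of k8q-c3 g6's hypothesis structure; its existence is the named fact, NOT
used here). No stub of 19606 is proved by name; the crux stays OPEN; nothing is booked; `BSD(W,p)` is
claimed for no pair. `--supports stmt-BirchSwinnertonDyer-19606`.

References: [Kobayashi2003] Thm. 7.3 i) (7.21), Cor. 7.2, Thm. 7.4 and its proof (p. 13), Thm. 6.2–6.3
(p. 11), §4 (p. 8); [Kato2004Asterisque] §17.13 (p. 280); [CoatesSujatha2005] §3 statement (A);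
[GreenbergVatsal2000] p. 2 (2); [Washington1997] §13.1–13.2; [NeukirchSchmidtWingberg2008] Ch. V §3;
[GreenbergLNM1716] §1 p. 60.
-/

set_option autoImplicit false
set_option linter.dupNamespace false

noncomputable section

open scoped Classical

open CongruenceSubgroup Field Function NumberField IsDedekindDomain WeierstrassCurve
open Literature.NumberTheory.EllipticCurves
open Literature.NumberTheory.EllipticCurves.ModularForms
open Literature.NumberTheory.EllipticCurves.Rank1Residual
open Literature.NumberTheory.EllipticCurves.Rank1Residual.Typed
open Literature.NumberTheory.GaloisRepresentations
open Literature.NumberTheory.GaloisCohomology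
open Literature.NumberTheory.EllipticCurves.IwasawaAlgebra
open Literature.NumberTheory.EllipticCurves.IwasawaDual ZpExtension
open Literature.NumberTheory.EllipticCurves.GreenbergVatsal2000
open Summit.BirchSwinnertonDyer.Rank1Residual.X11b.Levels
open Summit.BirchSwinnertonDyer.Rank1Residual.X11b
open Summit.BirchSwinnertonDyer.Rank1Residual.Additive
open Summit.BirchSwinnertonDyer.Rank1Residual.Additive.SignedTwist
open scoped ContRepresentation
open Summit.BirchSwinnertonDyer.Rank1Residual.AdditivePotMult

namespace Summit.BirchSwinnertonDyer.BirchSwinnertonDyer.Theorems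

namespace EtaFineRoad

/-! ## §1 `Λ`-algebra: the `μ`-projection of a four-term exact sequence `0 → A → Λ/(L) → X → B → 0` -/

section Algebra

variable {p : ℕ} [hp : Fact p.Prime]
variable {A X B : Type} [AddCommGroup A] [Module (IwasawaAlgebra p) A] [AddCommGroup X]
  [Module (IwasawaAlgebra p) X] [AddCommGroup B] [Module (IwasawaAlgebra p) B]

/-- **`char(X)·char(A) = (L)·char(B)`** along `0 → A → Λ/(L) → X → B → 0` (`L ≠ 0`, `B` finitely generated
torsion): with `q` the characteristic ideal of the image of `Λ/(L)` in `X`, `(L) = char(A)·q` and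
`char(X) = q·char(B)` (k8q-c3 g3's `Thm74Skeleton.exists_charIdeal_factor_of_fourTermExact`). The ideal
form of the additivity `μ(X) + μ(A) = μ(L) + μ(B)`, `λ` likewise. [cite: Kobayashi2003, proof of Thm. 7.4 (p. 13)]
[cite: NeukirchSchmidtWingberg2008, Ch. V §3] -/
theorem charIdeal_mul_charIdeal_eq_of_fourTermExact [Module.Finite (IwasawaAlgebra p) B]
    (hB : Module.IsTorsion (IwasawaAlgebra p) B) {L : IwasawaAlgebra p} (hL : L ≠ 0)
    (f : A →ₗ[IwasawaAlgebra p] IwasawaAlgebra p ⧸ Ideal.span {L})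
    (g : (IwasawaAlgebra p ⧸ Ideal.span {L}) →ₗ[IwasawaAlgebra p] X) (h : X →ₗ[IwasawaAlgebra p] B)
    (hf : Function.Injective f) (hfg : Function.Exact f g) (hgh : Function.Exact g h)
    (hh : Function.Surjective h) :
    Module.charIdeal (IwasawaAlgebra p) X * Module.charIdeal (IwasawaAlgebra p) A =
      Ideal.span {L} * Module.charIdeal (IwasawaAlgebra p) B := by
  obtain ⟨q, e1, e2⟩ := Thm74Skeleton.exists_charIdeal_factor_of_fourTermExact hB hL f g h hf hfg hgh hh
  rw [e1, e2]
  ring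

/-- **A characteristic generator `x` of `X` divides `b·L`** (`b` a characteristic generator of `B`):
`(x)·char(A) = (L)·(b) = (L·b)`, so `L·b ∈ (x)·char(A) ⊆ (x)`. [cite: Kobayashi2003, proof of Thm. 7.4 (p. 13)]
[cite: NeukirchSchmidtWingberg2008, Ch. V §3] -/
theorem charGenerator_dvd_mul_of_fourTermExact [Module.Finite (IwasawaAlgebra p) B]
    (hB : Module.IsTorsion (IwasawaAlgebra p) B) {L : IwasawaAlgebra p} (hL : L ≠ 0)
    (f : A →ₗ[IwasawaAlgebra p] IwasawaAlgebra p ⧸ Ideal.span {L})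
    (g : (IwasawaAlgebra p ⧸ Ideal.span {L}) →ₗ[IwasawaAlgebra p] X) (h : X →ₗ[IwasawaAlgebra p] B)
    (hf : Function.Injective f) (hfg : Function.Exact f g) (hgh : Function.Exact g h)
    (hh : Function.Surjective h) {x b : IwasawaAlgebra p}
    (hx : Module.charIdeal (IwasawaAlgebra p) X = Ideal.span {x})
    (hb : Module.charIdeal (IwasawaAlgebra p) B = Ideal.span {b}) : x ∣ b * L := by
  have key := charIdeal_mul_charIdeal_eq_of_fourTermExact hB hL f g h hf hfg hgh hh
  rw [hx, hb, Ideal.span_singleton_mul_span_singleton] at key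
  have hmem : L * b ∈ Ideal.span {x} * Module.charIdeal (IwasawaAlgebra p) A :=
    key ▸ Ideal.mem_span_singleton_self (L * b)
  have hmem' : L * b ∈ Ideal.span ({x} : Set (IwasawaAlgebra p)) := Ideal.mul_le_right hmem
  rw [mul_comm] at hmem'
  exact Ideal.mem_span_singleton.mp hmem'

/-- **The left end: a characteristic generator `a` of `A` divides `L`** (`A ↪ Λ/(L)`, so
`(L) = char(A)·q ⊆ char(A)`): `μ(𝐇¹(T)^η/Z(T)^η) ≤ μ(L_p⁺(V,η,X))` with no input at all.
[cite: Kobayashi2003, proof of Thm. 7.4 (p. 13)] [cite: NeukirchSchmidtWingberg2008, Ch. V §3] -/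
theorem charGenerator_left_dvd_of_fourTermExact [Module.Finite (IwasawaAlgebra p) B]
    (hB : Module.IsTorsion (IwasawaAlgebra p) B) {L : IwasawaAlgebra p} (hL : L ≠ 0)
    (f : A →ₗ[IwasawaAlgebra p] IwasawaAlgebra p ⧸ Ideal.span {L})
    (g : (IwasawaAlgebra p ⧸ Ideal.span {L}) →ₗ[IwasawaAlgebra p] X) (h : X →ₗ[IwasawaAlgebra p] B)
    (hf : Function.Injective f) (hfg : Function.Exact f g) (hgh : Function.Exact g h)
    (hh : Function.Surjective h) {a : IwasawaAlgebra p}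
    (ha : Module.charIdeal (IwasawaAlgebra p) A = Ideal.span {a}) : a ∣ L := by
  obtain ⟨q, e1, -⟩ := Thm74Skeleton.exists_charIdeal_factor_of_fourTermExact hB hL f g h hf hfg hgh hh
  have hmem : L ∈ Module.charIdeal (IwasawaAlgebra p) A * q := e1 ▸ Ideal.mem_span_singleton_self L
  have hmem' : L ∈ Module.charIdeal (IwasawaAlgebra p) A := Ideal.mul_le_right hmem
  rw [ha] at hmem'
  exact Ideal.mem_span_singleton.mp hmem'

/-- **`μ`-projection: `p ∤ L ∧ p ∤ b ⟹ p ∤ x`** along `0 → A → Λ/(L) → X → B → 0` (`x`, `b` characteristic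
generators of `X`, `B`): `x ∣ b·L` and `p` is a prime element of `Λ = ℤ_p⟦T⟧` (tree
`IwasawaAlgebra.prime_C`; unit content = `p ∤ ·`, Greenberg–Vatsal (2)). In words: `μ(X) ≤ μ(L) + μ(B)`,
so `μ(L) = μ(B) = 0 ⟹ μ(X) = 0`. [cite: GreenbergVatsal2000, p. 2 (2)] [cite: Washington1997, §13.1 and §13.2] -/
theorem hasUnitContent_of_fourTermExact [Module.Finite (IwasawaAlgebra p) B]
    (hB : Module.IsTorsion (IwasawaAlgebra p) B) {L : IwasawaAlgebra p} (hLu : HasUnitContent L)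
    (f : A →ₗ[IwasawaAlgebra p] IwasawaAlgebra p ⧸ Ideal.span {L})
    (g : (IwasawaAlgebra p ⧸ Ideal.span {L}) →ₗ[IwasawaAlgebra p] X) (h : X →ₗ[IwasawaAlgebra p] B)
    (hf : Function.Injective f) (hfg : Function.Exact f g) (hgh : Function.Exact g h)
    (hh : Function.Surjective h) {x b : IwasawaAlgebra p}
    (hx : Module.charIdeal (IwasawaAlgebra p) X = Ideal.span {x})
    (hb : Module.charIdeal (IwasawaAlgebra p) B = Ideal.span {b}) (hbu : HasUnitContent b) :
    HasUnitContent x := by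
  have hdvd := charGenerator_dvd_mul_of_fourTermExact hB (Summit.BirchSwinnertonDyer.Rank1Residual.X11a.ne_zero_of_hasUnitContent hLu) f g h hf hfg hgh
    hh hx hb
  rw [hasUnitContent_iff_not_C_dvd] at hLu hbu ⊢
  intro hpx
  rcases (IwasawaAlgebra.prime_C p).dvd_or_dvd (dvd_trans hpx hdvd) with hpb | hpL
  · exact hbu hpb
  · exact hLu hpL

/-- **The same with the right end in the cell's (A)-currency**: `B` finitely generated torsion over `Λ`
whose underlying `ℤ_p`-module is finitely generated (`μ(B) = 0`, Washington §13.2: tree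
`muInvariant_eq_zero_iff_holds`, `muInvariant_eq_zero_iff_hasUnitContent`) and `p ∤ L` `⟹` every
characteristic generator of `X` has unit content. [cite: Washington1997, §13.2] [cite: GreenbergVatsal2000, p. 2 (2)] -/
theorem hasUnitContent_of_fourTermExact_of_moduleFinite [Module.Finite (IwasawaAlgebra p) B]
    (hB : Module.IsTorsion (IwasawaAlgebra p) B)
    (hBZ : Module.Finite ℤ_[p] (RestrictScalars ℤ_[p] (IwasawaAlgebra p) B))
    {L : IwasawaAlgebra p} (hLu : HasUnitContent L)
    (f : A →ₗ[IwasawaAlgebra p] IwasawaAlgebra p ⧸ Ideal.span {L})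
    (g : (IwasawaAlgebra p ⧸ Ideal.span {L}) →ₗ[IwasawaAlgebra p] X) (h : X →ₗ[IwasawaAlgebra p] B)
    (hf : Function.Injective f) (hfg : Function.Exact f g) (hgh : Function.Exact g h)
    (hh : Function.Surjective h) {x : IwasawaAlgebra p}
    (hx : Module.charIdeal (IwasawaAlgebra p) X = Ideal.span {x}) : HasUnitContent x := by
  haveI : (Module.charIdeal (IwasawaAlgebra p) B).IsPrincipal := charIdeal_isPrincipal_holds p B
  obtain ⟨b, hb⟩ := Submodule.IsPrincipal.principal (Module.charIdeal (IwasawaAlgebra p) B)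
  have hb' : Module.charIdeal (IwasawaAlgebra p) B = Ideal.span {b} := hb
  have hbu : HasUnitContent b :=
    (muInvariant_eq_zero_iff_hasUnitContent B hB hb').mp ((muInvariant_eq_zero_iff_holds p B hB).mpr hBZ)
  exact hasUnitContent_of_fourTermExact hB hLu f g h hf hfg hgh hh hx hb' hbu

/-- Torsion passes to quotients: `X ↠ B` with `X` torsion `⟹` `B` torsion. [folklore] -/
theorem isTorsion_of_surjective (hX : Module.IsTorsion (IwasawaAlgebra p) X)
    (k : X →ₗ[IwasawaAlgebra p] B) (hk : Function.Surjective k) : Module.IsTorsion (IwasawaAlgebra p) B := by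
  intro y
  obtain ⟨x, rfl⟩ := hk y
  obtain ⟨s, hs⟩ := @hX x
  exact ⟨s, by rw [Submonoid.smul_def, ← map_smul, ← Submonoid.smul_def, hs, map_zero]⟩

/-- **Converse projection: `μ(X) = 0 ⟹` every quotient `B` of `X` is finitely generated over `ℤ_p`.**
For `X` finitely generated torsion with a characteristic generator of unit content and `k : X ↠ B`:
`μ(X) = μ(ker k) + μ(B)` (tree `muInvariant_add_of_shortExact_holds`) forces `μ(B) = 0`, i.e. `B`
finitely generated over `ℤ_p` (Washington §13.2). For `X = X⁺(V/K_∞)^η ↠ B = X⁰(W/ℚ_∞)` this is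
"`μ`-stub of 19606 ⟹ (A) for `W`". [cite: Washington1997, §13.2] [cite: GreenbergVatsal2000, p. 2 (2)] -/
theorem moduleFinite_padicInt_of_surjective_of_hasUnitContent [Module.Finite (IwasawaAlgebra p) X]
    (hX : Module.IsTorsion (IwasawaAlgebra p) X) {x : IwasawaAlgebra p}
    (hx : Module.charIdeal (IwasawaAlgebra p) X = Ideal.span {x}) (hxu : HasUnitContent x)
    (k : X →ₗ[IwasawaAlgebra p] B) (hk : Function.Surjective k) :
    Module.Finite ℤ_[p] (RestrictScalars ℤ_[p] (IwasawaAlgebra p) B) := by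
  have hμX : muInvariant p X = 0 := (muInvariant_eq_zero_iff_hasUnitContent X hX hx).mpr hxu
  have hadd := muInvariant_add_of_shortExact_holds p X hX (LinearMap.ker k).subtype k
    (Submodule.injective_subtype _) hk (LinearMap.exact_subtype_ker_map k)
  have hμB : muInvariant p B = 0 := by omega
  haveI : Module.Finite (IwasawaAlgebra p) B := Module.Finite.of_surjective k hk
  exact (muInvariant_eq_zero_iff_holds p B (isTorsion_of_surjective hX k hk)).mp hμB

end Algebra

/-! ## §2 On the PINNED `η`-frame of Kobayashi's Thm. 6.2 / 6.3 / 7.3 i) / Cor. 7.2 (seat k8q-c3 g6) -/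

section Frame

variable {p : ℕ} [hp : Fact p.Prime] {K₀ : Type} [Field K₀] [NumberField K₀]
  [(galRange (K := ℚ) K₀).Normal] {ηq : absoluteGaloisGroup ℚ →* ℤˣ}
  {V : WeierstrassCurve ℚ} [V.IsElliptic] {N : ℕ} {f : CuspForm (Gamma0 N) 2} {ϖ : ℚ}
  {κ : ZpExtension ℚ p} {γ : absoluteGaloisGroup ℚ}
  {W : WeierstrassCurve ℚ} [W.IsElliptic] [ContinuousSMul ℤ_[p] (W.tateModule p)]
  {I : Kato2004.IwasawaH1Data W p κ γ} {FB : W.FineSelmerDualData κ γ}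

/-- **The plus `η`-four-term sequence on pinned objects**: from a frame datum `E` (Thm. 6.2 (6.13) +
Thm. 6.3 + (7.21) + Cor. 7.2 at `η`) and a Pontryagin-dual datum `D` of `Sel⁺(V/K_∞)^η`:
`0 → 𝐇¹_Γ(T_pW)/Λz → Λ/(Col⁺z) → X(D) → X⁰(W/ℚ_∞) → 0` exact (k8q-c3 g5's
`Thm74Skeleton.exists_fourTermExact_of_threeTermExact`). [cite: Kobayashi2003, Thm. 7.3 i) (7.21) and proof of Thm. 7.4 (p. 13)] -/
theorem exists_fourTermExact_plus
    (E : Kobayashi2003.EtaColemanPoitouTateData p K₀ ηq V f ϖ κ γ W I FB)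
    (D : Kobayashi2003.EtaSignedSelmerDualData V κ K₀ ℚ_[p] ηq γ 1) :
    ∃ (i : (I.H ⧸ Submodule.span (IwasawaAlgebra p) {E.z}) →ₗ[IwasawaAlgebra p]
        (IwasawaAlgebra p ⧸ Ideal.span {E.colPlus E.z}))
      (j' : (IwasawaAlgebra p ⧸ Ideal.span {E.colPlus E.z}) →ₗ[IwasawaAlgebra p] D.X)
      (k' : D.X →ₗ[IwasawaAlgebra p] FB.X),
      Function.Injective i ∧ Function.Exact i j' ∧ Function.Exact j' k' ∧ Function.Surjective k' := by
  obtain ⟨j, k, hcj, hjk, hk⟩ := E.exact_plus D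
  exact Thm74Skeleton.exists_fourTermExact_of_threeTermExact E.colPlus j k E.colPlus_injective hcj hjk hk E.z

/-- **FINE ROAD on the pinned frame (⟸).** If `Col⁺(z) = L_p⁺(V,η,X)` has unit content (analytic `μ = 0`
at `η`) and the dual fine Selmer group `X⁰(W/ℚ_∞)` of the twist is finitely generated over `ℤ_p`
(statement (A) for `W` at `p`), then EVERY characteristic generator of EVERY Pontryagin-dual datum of
`Sel⁺(V/K_∞)^η` has unit content — `μ(X⁺(V/K_∞)^η) = 0`. §1 on §2's sequence; `X⁰` finitely generated
over `Λ` by the tree theorem `FineSelmerDualData.module_finite`, torsion by the frame (Cor. 7.2).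
[cite: Kobayashi2003, Thm. 7.3 i) (7.21), Cor. 7.2, proof of Thm. 7.4 (p. 13)] [cite: CoatesSujatha2005, §3 statement (A)]
[cite: GreenbergVatsal2000, p. 2 (2)] -/
theorem eta_hasUnitContent_of_fine
    (E : Kobayashi2003.EtaColemanPoitouTateData p K₀ ηq V f ϖ κ γ W I FB) (hγ : κ.IsTopGenerator γ)
    (hLu : HasUnitContent (E.colPlus E.z))
    (hFB : Module.Finite ℤ_[p] (RestrictScalars ℤ_[p] (IwasawaAlgebra p) FB.X))
    (D : Kobayashi2003.EtaSignedSelmerDualData V κ K₀ ℚ_[p] ηq γ 1) {g : IwasawaAlgebra p}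
    (hg : D.charIdeal = Ideal.span {g}) : HasUnitContent g := by
  haveI : Module.Finite (IwasawaAlgebra p) FB.X := WeierstrassCurve.FineSelmerDualData.module_finite _ κ hγ FB
  obtain ⟨i, j', k', hi, hij, hjk, hk⟩ := exists_fourTermExact_plus E D
  exact hasUnitContent_of_fourTermExact_of_moduleFinite E.isTorsion_fine hFB hLu i j' k' hi hij hjk hk hg

/-- **FINE ROAD on the pinned frame (⟹).** If ONE finitely generated torsion Pontryagin-dual datum `D` of
`Sel⁺(V/K_∞)^η` has a characteristic generator of unit content (`μ(X⁺(V/K_∞)^η) = 0`), then `X⁰(W/ℚ_∞)`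
is finitely generated over `ℤ_p` — statement (A) for `W` at `p` — along `X(D) ↠ X⁰(W/ℚ_∞)` ((7.21)).
So the `μ`-stubs of crux 19606 are AT LEAST Coates–Sujatha's (A) on the additive partners.
[cite: Kobayashi2003, Thm. 7.3 i) (7.21) (p. 13)] [cite: CoatesSujatha2005, §3 statement (A)] [cite: Washington1997, §13.2] -/
theorem fine_moduleFinite_of_eta_hasUnitContent
    (E : Kobayashi2003.EtaColemanPoitouTateData p K₀ ηq V f ϖ κ γ W I FB)
    (D : Kobayashi2003.EtaSignedSelmerDualData V κ K₀ ℚ_[p] ηq γ 1)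
    [Module.Finite (IwasawaAlgebra p) D.X] (hD : Module.IsTorsion (IwasawaAlgebra p) D.X)
    {g : IwasawaAlgebra p} (hg : D.charIdeal = Ideal.span {g}) (hgu : HasUnitContent g) :
    Module.Finite ℤ_[p] (RestrictScalars ℤ_[p] (IwasawaAlgebra p) FB.X) := by
  obtain ⟨j, k, -, -, hk⟩ := E.exact_plus D
  exact moduleFinite_padicInt_of_surjective_of_hasUnitContent hD hg hgu k hk

/-- **And the left end comes for free**: on the pinned frame, if `Col⁺(z)` has unit content then so does
every characteristic generator of `𝐇¹_Γ(T_pW)/Λz` («`𝐇¹(T)^η/Z(T)^η`»): `μ(𝐇¹/Z) ≤ μ_an`. Recorded to make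
the bookkeeping `μ(X⁺) = μ_an − μ(𝐇¹/Z) + μ(X⁰)` explicit: under `μ_an = 0`, `μ(X⁺(V/K_∞)^η) = μ(X⁰(W/ℚ_∞))`.
[cite: Kobayashi2003, Thm. 7.3 i) (7.21) and proof of Thm. 7.4 (p. 13)] [cite: GreenbergVatsal2000, p. 2 (2)] -/
theorem left_hasUnitContent_of_analyticMu
    (E : Kobayashi2003.EtaColemanPoitouTateData p K₀ ηq V f ϖ κ γ W I FB) (hγ : κ.IsTopGenerator γ)
    (hLu : HasUnitContent (E.colPlus E.z))
    (D : Kobayashi2003.EtaSignedSelmerDualData V κ K₀ ℚ_[p] ηq γ 1) {a : IwasawaAlgebra p}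
    (ha : Module.charIdeal (IwasawaAlgebra p) (I.H ⧸ Submodule.span (IwasawaAlgebra p) {E.z}) =
      Ideal.span {a}) : HasUnitContent a := by
  haveI : Module.Finite (IwasawaAlgebra p) FB.X := WeierstrassCurve.FineSelmerDualData.module_finite _ κ hγ FB
  obtain ⟨i, j', k', hi, hij, hjk, hk⟩ := exists_fourTermExact_plus E D
  have hdvd := charGenerator_left_dvd_of_fourTermExact E.isTorsion_fine (Summit.BirchSwinnertonDyer.Rank1Residual.X11a.ne_zero_of_hasUnitContent hLu)
    i j' k' hi hij hjk hk ha
  rw [hasUnitContent_iff_not_C_dvd] at hLu ⊢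
  exact fun h => hLu (dvd_trans h hdvd)

end Frame

end EtaFineRoad

end Summit.BirchSwinnertonDyer.BirchSwinnertonDyer.Theorems

end
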